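import Literature.Probability.RandomPlanarGeometry.SAWTriangularLoopRatioLimit
import Literature.Probability.RandomPlanarGeometry.SAWTriangularPolygonGrowth
import HarnessLib

/-!
# The one-step ratio theorem for self-avoiding polygons of `𝕋`, unconditional («TRI-SAP-RATIO», R82 — FINAL)

Topic `Literature/Probability/RandomPlanarGeometry` (lane «pcv-sawmu», route R82 «TRI-SAP-RATIO(-RATE)»). Sources:
N. Madras, G. Slade, *The Self-Avoiding Walk* (1993), Theorem 7.3.4 (c) p. 248 (the polygon ratio theorem on `ℤ^d`,
printed in TWO-step form `q_{2N+2}/q_{2N} → μ²` — «a direct consequence of part (b) and the basic relation (3.2.1)»,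
eq. (3.2.1) p. 63; on `ℤ^d` polygons have even length), Theorem 7.3.2 (Kesten's inequality (7.3.4), p. 244; proof with
(7.3.5)–(7.3.7), pp. 245–247), Lemma 7.3.1 p. 242, and the Remark p. 244 (on a lattice with a pair of patterns whose
lengths differ by one, «for example the triangular lattice», the argument gives the ONE-step limit `c_{N+1}/c_N → μ`);
for polygons of the triangular lattice no printed statement or proof was located (lane label: first written proof,
first kernel text). (Theorem 7.4.5 p. 254, cited by an earlier edition of this header, is the END-PATTERN ratio theorem
and is not used here.)

This file discharges the log-envelope hypothesis of `SAWTriangularLoopKesten.lean` / `SAWTriangularLoopRatioLimit.lean`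
(a-p2) by a-p3's R81 envelope `abs_log_triLoopCount_sub_le` (`SAWTriangularPolygonGrowth.lean`), in the lane's
token `triLoopCount N = #((brickSaws (N-1)).filter fun ω => brickGraph.Adj (ω (N-1)) 0)` (rooted oriented
`N`-edge self-avoiding polygons of `𝕋` through `0`, a-p3's `SAWTriangularPolygonPairs.lean`). Planner a-idea-1 g13's
R82 faces `TriSAPKesten`, `TriLoopRatio`, `TriSAPRatio`, `TriSAPMonoZ` are the bodies below, verbatim.

## Contents (namespace `Literature.Probability.RandomPlanarGeometry.SAW`; all PROVED, no hypotheses, axioms standard)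

* **`triSAPKesten`**: `∃ D, ∀ᶠ N, (t_{N+1}/t_N)² − D/N ≤ (t_{N+1}/t_N)(t_{N+2}/t_{N+1})` (Kesten's inequality for
  polygons of `𝕋`);
* **`triLoopRatio`**: `t_{N+1}/t_N → μ(𝕋) = exp logMuTri`;
* **`triSAPRatio`**: `N t_{N+1} / ((N+1) t_N) → μ(𝕋)` (the `q`-normalised form, `q_N = t_N/(2N)`);
* **`triSAPMonoZ`**: `∃ Z ≥ 1, ∃ n₀, ∀ n ≥ n₀, t_n ≤ Z t_{n+1}` (from a-p3's `triLoopCount_le_succ`, `Z = 1`).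
-/

noncomputable section

open Finset Filter Topology Literature.Probability.LatticeModels Literature.Probability.Percolation SimpleGraph
open scoped BigOperators

namespace Literature.Probability.RandomPlanarGeometry.SAW

/-- **Kesten's inequality for self-avoiding polygons of `𝕋`** (planner face `TriSAPKesten`, no hypotheses):
`∃ D, ∀ᶠ N, (t_{N+1}/t_N)² − D/N ≤ (t_{N+1}/t_N) · (t_{N+2}/t_{N+1})`.
[cite: MadrasSlade1993, Theorem 7.3.2, eq. (7.3.4), p. 244 (proof (7.3.5)–(7.3.7), pp. 245–247);
Theorem 7.3.4 (c), p. 248] -/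
theorem triSAPKesten : ∃ D : ℝ, ∀ᶠ N : ℕ in atTop,
    ((triLoopCount (N + 1) : ℝ) / triLoopCount N) ^ 2 - D / N ≤
      ((triLoopCount (N + 1) : ℝ) / triLoopCount N) * ((triLoopCount (N + 2) : ℝ) / triLoopCount (N + 1)) :=
  triLoopKesten_of_logEnvelope fun _ hN => abs_log_triLoopCount_sub_le hN

/-- **The one-step ratio theorem for rooted self-avoiding polygons of `𝕋`** (planner face `TriLoopRatio`, no
hypotheses): `t_{N+1}(𝕋)/t_N(𝕋) → μ(𝕋)`. [cite: MadrasSlade1993, Theorem 7.3.4 (c), p. 248 (printed two-step on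
`ℤ^d`); Remark p. 244 (one step on the triangular lattice)] -/
theorem triLoopRatio :
    Tendsto (fun N : ℕ => (triLoopCount (N + 1) : ℝ) / triLoopCount N) atTop (𝓝 (Real.exp logMuTri)) :=
  triLoopRatio_of_logEnvelope fun _ hN => abs_log_triLoopCount_sub_le hN

/-- **The one-step ratio theorem for self-avoiding polygons of `𝕋` counted up to translation** (planner face
`TriSAPRatio`, no hypotheses): with `q_N = t_N/(2N)`, `q_{N+1}/q_N = N t_{N+1}/((N+1) t_N) → μ(𝕋)`.
[cite: MadrasSlade1993, Theorem 7.3.4 (c), p. 248; eq. (3.2.1) p. 63] -/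
theorem triSAPRatio :
    Tendsto (fun N : ℕ => (N : ℝ) * triLoopCount (N + 1) / (((N : ℝ) + 1) * triLoopCount N)) atTop
      (𝓝 (Real.exp logMuTri)) :=
  triSAPRatio_of_logEnvelope fun _ hN => abs_log_triLoopCount_sub_le hN

/-- **Eventual monotonicity up to a constant** (planner door `TriSAPMonoZ`, with `Z = 1`, `n₀ = 3`), from a-p3's
`triLoopCount_le_succ`. [cite: MadrasSlade1993, Theorem 7.3.2 (proof, monotonicity input), p. 245] -/
theorem triSAPMonoZ : ∃ Z : ℕ, 1 ≤ Z ∧ ∃ n₀ : ℕ, ∀ n : ℕ, n₀ ≤ n → triLoopCount n ≤ Z * triLoopCount (n + 1) :=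
  ⟨1, le_rfl, 3, fun n hn => by rw [one_mul]; exact triLoopCount_le_succ hn⟩

end Literature.Probability.RandomPlanarGeometry.SAW
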